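import Literature.Analysis.FluidPDE.SereginSverakAxisymmetric
import HarnessLib

/-!
# Seregin–Šverák 2009, Lemma 3.5: the elementary iteration behind the scaled energy bound

G. Seregin, V. Šverák, *On Type I singularities of the local axi-symmetric solutions of the
Navier–Stokes equations*, Comm. PDE 34 (2009), 171–201 = arXiv:0804.1803. Lemma 3.5 (arXiv
p. 9; the accepted named fact `SereginSverak2009.ScaledEnergyBound` of
`SereginSverakAxisymmetric.lean`) bounds `A + E + C + D` at the centres `z_b = (b e₃, 0)`,
`|b| ≤ 1/4`, and radii `0 < r < 1/4`. Its printed proof (arXiv pp. 9–10) feeds four analytic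
inputs — (as6) `A(0,3/4) + E(0,3/4) < ∞`, (as11) `C ≤ ε (E + A) + f₁(ε)`, (as12) the local energy
inequality `E(r/2) + A(r/2) ≤ c (C^{2/3} + C + D)(r)`, (as13) the pressure decay
`D(ϱ) ≤ c [(ϱ/r) D(r) + (r/ϱ)² C(r)]` — into an elementary iteration ("The rest of the proof is
routine", p. 10): `ℰ = E + A + D` satisfies `ℰ(ϑr) ≤ c(ϑ + ε/ϑ²) ℰ(r) + f₂`, hence, for suitable
`ϑ` then `ε`, `ℰ(ϑ r) ≤ ½ ℰ(r) + f₃`, which iterates down from the scales `r ∼ 1/4`.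

This file PROVES the solution-independent part of that argument, over the accepted functionals
`SereginSverak2009.energyA / dissipationE / cubicC / pressureD` (`ℝ≥0∞`-valued):

* geometry of the axis-centred cylinders: `eZ_apply_*`, `cylRadius_sub_smul_eZ`,
  `SereginSverak2009.spaceCyl_axis_subset`, `SereginSverak2009.parCyl_axis_subset`
  (`Q(z_b, r) ⊆ Q(0, R)` once `|b| + r ≤ R`);
* monotonicity of the functionals in the cylinder (`…_le_of_subset`: `X(z, r) ≤ (r'/r)^κ X(z', r')`
  when `Q(z, r) ⊆ Q(z', r')`), in particular the scaling `C(z, κr) ≤ κ⁻² C(z, r)`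
  (`cubicC_mul_le`) used at `κ = 2ϑ` in the printed display after (as13);
* the abstract scheme: `decay_step` (one passage `r ↦ ϑ r` from abstract (as12), (as13) and the
  scaling of `C`), `decay_step_half` (adding (as11) and the smallness of `ϑ`, `ε`:
  `ℰ(ϑr) ≤ ½ ℰ(r) + f₃`), `iterate_halving` (`ℰ ≤ M + 2 f₃` on `(0, R)` from the contraction and a
  bound `M` on the top scales `[r₀, R)`, `r₀ ≤ ϑ R`), and the choice of parameters
  `exists_ratio`, `exists_parameter`.

Everything is stated in `ℝ≥0∞` with `ℝ≥0` constants, so that no finiteness provisos are needed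
(the contraction is iterated without subtracting). The companion file
`SereginSverakScaledEnergy.lean` vendors the four inputs as named facts and assembles Lemma 3.5.

## References

* G. Seregin, V. Šverák, Comm. PDE 34 (2009), 171–201, arXiv:0804.1803, §3, Lemma 3.5 and its
  proof, (as4)–(as13) and the displays following (as13) (pp. 9–10). [`SereginSverak2009`]
-/

noncomputable section

open MeasureTheory Set Function Filter Topology TopologicalSpace
open scoped NNReal ENNReal

namespace Literature.Analysis.FluidPDE

/-! ### The axial unit vector -/

/-- `e₃` has vanishing first component. [folklore] -/
@[simp] theorem eZ_apply_zero : eZ 0 = 0 := by simp [eZ]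

/-- `e₃` has vanishing second component. [folklore] -/
@[simp] theorem eZ_apply_one : eZ 1 = 0 := by simp [eZ]

/-- `e₃` has third component `1`. [folklore] -/
@[simp] theorem eZ_apply_two : eZ 2 = 1 := by simp [eZ]

/-- Translating along the axis does not change the distance to the axis:
`|(x - b e₃)'| = |x'|`. [folklore] -/
theorem cylRadius_sub_smul_eZ (x : EuclideanSpace ℝ (Fin 3)) (b : ℝ) :
    cylRadius (x - b • eZ) = cylRadius x := by
  simp [cylRadius]

namespace SereginSverak2009

/-! ### Geometry of the cylinders centred on the axis -/

/-- `𝒞(b e₃, r) ⊆ 𝒞(0, R)` as soon as `|b| + r ≤ R` (used with `|b| ≤ 1/4`, `r < 1/4`,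
`R = 3/4`: the inclusion `Q(z_b, r) ⊆ Q(0, 3/4)` behind the use of (as6) in the proof of
Lemma 3.5). [cite: SereginSverak2009, proof of Lemma 3.5 (last display, arXiv p. 10)] -/
theorem spaceCyl_axis_subset {b r R : ℝ} (h : |b| + r ≤ R) :
    spaceCyl (b • eZ) r ⊆ spaceCyl 0 R := by
  intro x hx
  rw [mem_spaceCyl] at hx ⊢
  rw [cylRadius_sub_smul_eZ] at hx
  have hb : 0 ≤ |b| := abs_nonneg b
  have h2 : |x 2| ≤ |x 2 - b| + |b| := by
    calc |x 2| = |(x 2 - b) + b| := by ring_nf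
      _ ≤ |x 2 - b| + |b| := abs_add_le _ _
  simp only [sub_zero, PiLp.zero_apply]
  simp only [PiLp.smul_apply, eZ_apply_two, smul_eq_mul, mul_one] at hx
  exact ⟨by linarith [hx.1], by linarith [hx.2]⟩

/-- `Q((0, b e₃), r) ⊆ Q(0, R)` as soon as `0 ≤ r` and `|b| + r ≤ R`.
[cite: SereginSverak2009, proof of Lemma 3.5 (last display, arXiv p. 10)] -/
theorem parCyl_axis_subset {b r R : ℝ} (hr : 0 ≤ r) (h : |b| + r ≤ R) :
    parCyl ((0 : ℝ), b • eZ) r ⊆ parCyl 0 R := by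
  intro z hz
  have hR : r ≤ R := le_trans (by linarith [abs_nonneg b]) h
  have h2 : r ^ 2 ≤ R ^ 2 := pow_le_pow_left₀ hr hR 2
  refine ⟨⟨?_, ?_⟩, spaceCyl_axis_subset h hz.2⟩
  · have := hz.1.1; dsimp only at this; simp only [Prod.fst_zero]; linarith
  · have := hz.1.2; dsimp only at this; simp only [Prod.fst_zero]; linarith

/-! ### Monotonicity of the functionals in the cylinder -/

variable {u : ℝ → EuclideanSpace ℝ (Fin 3) → EuclideanSpace ℝ (Fin 3)}
  {p : ℝ → EuclideanSpace ℝ (Fin 3) → ℝ}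
  {G : ℝ → EuclideanSpace ℝ (Fin 3) → EuclideanSpace ℝ (Fin 3) →L[ℝ] EuclideanSpace ℝ (Fin 3)}

/-- `(r'/r)` in `ℝ≥0∞` as `r⁻¹ r'`, `r > 0`. [folklore] -/
theorem ofReal_div_eq_inv_mul {r : ℝ} (hr : 0 < r) (r' : ℝ) :
    ENNReal.ofReal (r' / r) = (ENNReal.ofReal r)⁻¹ * ENNReal.ofReal r' := by
  rw [ENNReal.ofReal_div_of_pos hr, div_eq_mul_inv, mul_comm]

/-- `(r'/r)²` in `ℝ≥0∞` as `(r²)⁻¹ r'²`, `r > 0`. [folklore] -/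
theorem ofReal_div_sq_eq_inv_mul {r r' : ℝ} (hr : 0 < r) (hr' : 0 ≤ r') :
    ENNReal.ofReal ((r' / r) ^ 2) = (ENNReal.ofReal r ^ 2)⁻¹ * ENNReal.ofReal r' ^ 2 := by
  rw [div_pow, ENNReal.ofReal_div_of_pos (pow_pos hr 2), ENNReal.ofReal_pow hr',
    ENNReal.ofReal_pow hr.le, div_eq_mul_inv, mul_comm]

/-- Monotonicity of `E` in the cylinder: `E(z, r) ≤ (r'/r) E(z', r')` when `Q(z, r) ⊆ Q(z', r')`
(integral of a nonnegative function over a smaller set). [folklore] -/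
theorem dissipationE_le_of_subset {z z' : ℝ × EuclideanSpace ℝ (Fin 3)} {r r' : ℝ} (hr : 0 < r)
    (hr' : 0 < r')
    (h : parCyl z r ⊆ parCyl z' r') :
    dissipationE z r G ≤ ENNReal.ofReal (r' / r) * dissipationE z' r' G := by
  rw [ofReal_div_eq_inv_mul hr r']
  unfold dissipationE
  have h0 : ENNReal.ofReal r' ≠ 0 := by simpa using hr'
  rw [mul_assoc, ← mul_assoc (ENNReal.ofReal r') _ _,
    ENNReal.mul_inv_cancel h0 ENNReal.ofReal_ne_top, one_mul]
  gcongr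

/-- Monotonicity of `A` in the cylinder: `A(z, r) ≤ (r'/r) A(z', r')` when the time interval and
the spatial cylinder of `Q(z, r)` lie inside those of `Q(z', r')` (pointwise smaller slice
integrals, essential supremum over a smaller set). [folklore] -/
theorem energyA_le_of_subset {z z' : ℝ × EuclideanSpace ℝ (Fin 3)} {r r' : ℝ} (hr : 0 < r)
    (hr' : 0 < r')
    (ht : Ioo (z.1 - r ^ 2) z.1 ⊆ Ioo (z'.1 - r' ^ 2) z'.1)
    (hx : spaceCyl z.2 r ⊆ spaceCyl z'.2 r') :
    energyA z r u ≤ ENNReal.ofReal (r' / r) * energyA z' r' u := by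
  rw [ofReal_div_eq_inv_mul hr r']
  unfold energyA
  have h0 : ENNReal.ofReal r' ≠ 0 := by simpa using hr'
  conv_rhs => rw [ENNReal.essSup_const_mul, mul_assoc, ← mul_assoc (ENNReal.ofReal r') _ _,
    ENNReal.mul_inv_cancel h0 ENNReal.ofReal_ne_top, one_mul, ← ENNReal.essSup_const_mul]
  calc essSup (fun t : ℝ => (ENNReal.ofReal r)⁻¹ * ∫⁻ x in spaceCyl z.2 r, ‖u t x‖ₑ ^ 2)
        (volume.restrict (Ioo (z.1 - r ^ 2) z.1))
      ≤ essSup (fun t : ℝ => (ENNReal.ofReal r)⁻¹ * ∫⁻ x in spaceCyl z'.2 r', ‖u t x‖ₑ ^ 2)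
        (volume.restrict (Ioo (z.1 - r ^ 2) z.1)) := by
        refine essSup_mono_ae (Eventually.of_forall fun t => ?_)
        dsimp only
        gcongr
    _ ≤ essSup (fun t : ℝ => (ENNReal.ofReal r)⁻¹ * ∫⁻ x in spaceCyl z'.2 r', ‖u t x‖ₑ ^ 2)
        (volume.restrict (Ioo (z'.1 - r' ^ 2) z'.1)) :=
        essSup_mono_measure' (Measure.restrict_mono ht le_rfl)

/-- Monotonicity of `C` in the cylinder: `C(z, r) ≤ (r'/r)² C(z', r')` when `Q(z, r) ⊆ Q(z', r')`;
in particular the scaling `C(z_b, 2ϑr) ≤ (2ϑ)⁻² C(z_b, r)` of the printed iteration. [folklore] -/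
theorem cubicC_le_of_subset {z z' : ℝ × EuclideanSpace ℝ (Fin 3)} {r r' : ℝ} (hr : 0 < r)
    (hr' : 0 < r')
    (h : parCyl z r ⊆ parCyl z' r') :
    cubicC z r u ≤ ENNReal.ofReal ((r' / r) ^ 2) * cubicC z' r' u := by
  rw [ofReal_div_sq_eq_inv_mul hr hr'.le]
  unfold cubicC
  have h0 : ENNReal.ofReal r' ^ 2 ≠ 0 := pow_ne_zero _ (by simpa using hr')
  have hT : ENNReal.ofReal r' ^ 2 ≠ ⊤ := ENNReal.pow_ne_top ENNReal.ofReal_ne_top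
  rw [mul_assoc, ← mul_assoc (ENNReal.ofReal r' ^ 2) _ _, ENNReal.mul_inv_cancel h0 hT, one_mul]
  gcongr

/-- Monotonicity of `D` in the cylinder: `D(z, r) ≤ (r'/r)² D(z', r')` when
`Q(z, r) ⊆ Q(z', r')`. [folklore] -/
theorem pressureD_le_of_subset {z z' : ℝ × EuclideanSpace ℝ (Fin 3)} {r r' : ℝ} (hr : 0 < r)
    (hr' : 0 < r')
    (h : parCyl z r ⊆ parCyl z' r') :
    pressureD z r p ≤ ENNReal.ofReal ((r' / r) ^ 2) * pressureD z' r' p := by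
  rw [ofReal_div_sq_eq_inv_mul hr hr'.le]
  unfold pressureD
  have h0 : ENNReal.ofReal r' ^ 2 ≠ 0 := pow_ne_zero _ (by simpa using hr')
  have hT : ENNReal.ofReal r' ^ 2 ≠ ⊤ := ENNReal.pow_ne_top ENNReal.ofReal_ne_top
  rw [mul_assoc, ← mul_assoc (ENNReal.ofReal r' ^ 2) _ _, ENNReal.mul_inv_cancel h0 hT, one_mul]
  gcongr

/-- The ratio `(r / (κ r))² = κ⁻²` in `ℝ≥0∞`, for `κ, r > 0`. [folklore] -/
theorem ofReal_div_mul_self_sq {κ : ℝ≥0} {r : ℝ} (hκ : 0 < κ) (hr : 0 < r) :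
    ENNReal.ofReal ((r / ((κ : ℝ) * r)) ^ 2) = ((κ⁻¹ ^ 2 : ℝ≥0) : ℝ≥0∞) := by
  have hκR : (κ : ℝ) ≠ 0 := by exact_mod_cast hκ.ne'
  rw [div_mul_cancel_right₀ hr.ne' (κ : ℝ),
    show ((κ : ℝ)⁻¹ ^ 2 : ℝ) = ((κ⁻¹ ^ 2 : ℝ≥0) : ℝ) by push_cast; ring, ENNReal.ofReal_coe_nnreal]

/-- The scaling of `C` used in the printed iteration: `C(z, κ r) ≤ κ⁻² C(z, r)` for
`0 < κ ≤ 1`. [cite: SereginSverak2009, proof of Lemma 3.5 (arXiv p. 10)] -/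
theorem cubicC_mul_le (z : ℝ × EuclideanSpace ℝ (Fin 3))
    (u : ℝ → EuclideanSpace ℝ (Fin 3) → EuclideanSpace ℝ (Fin 3)) {r : ℝ} (hr : 0 < r) {κ : ℝ≥0}
    (hκ : 0 < κ) (hκ1 : κ ≤ 1) :
    cubicC z ((κ : ℝ) * r) u ≤ ((κ⁻¹ ^ 2 : ℝ≥0) : ℝ≥0∞) * cubicC z r u := by
  have hκR : (0 : ℝ) < κ := by exact_mod_cast hκ
  have hκ1R : (κ : ℝ) ≤ 1 := by exact_mod_cast hκ1
  have hsub : parCyl z ((κ : ℝ) * r) ⊆ parCyl z r :=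
    parCyl_mono z (by positivity) (mul_le_of_le_one_left hr.le hκ1R)
  rw [← ofReal_div_mul_self_sq hκ hr]
  exact cubicC_le_of_subset (by positivity) hr hsub

/-! ### The elementary iteration, abstractly -/

/-- `x^{2/3} ≤ x + 1` in `ℝ≥0∞` (how `C^{2/3}` is majorised by `C` in the printed iteration).
[folklore] -/
theorem rpow_two_thirds_le_add_one (x : ℝ≥0∞) : x ^ (2 / 3 : ℝ) ≤ x + 1 := by
  rcases le_total x 1 with h | h
  · exact (ENNReal.rpow_le_one h (by norm_num)).trans le_add_self
  · calc x ^ (2 / 3 : ℝ) ≤ x ^ (1 : ℝ) := ENNReal.rpow_le_rpow_of_exponent_le h (by norm_num)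
      _ = x := ENNReal.rpow_one x
      _ ≤ x + 1 := le_self_add

/-- **Halving iteration** (the "easily iterated" step of the printed proof, arXiv p. 10): if
`Φ(ϑ r) ≤ ½ Φ(r) + B` for `0 < r < R` and `Φ ≤ M` on `[r₀, R)` with `0 < r₀ ≤ ϑ R`, `0 < ϑ < 1`,
then `Φ ≤ M + 2B` on `(0, R)` (induction on the number of steps `k` with `ϑᵏ r₀ ≤ r`; no
subtraction is used, so `ℝ≥0∞` values are allowed).
[cite: SereginSverak2009, proof of Lemma 3.5 (arXiv p. 10)] -/
theorem iterate_halving {Φ : ℝ → ℝ≥0∞} {ϑ r₀ R : ℝ} {B M : ℝ≥0∞} (hϑ : 0 < ϑ) (hϑ1 : ϑ < 1)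
    (hr₀ : 0 < r₀) (hr₀R : r₀ ≤ ϑ * R)
    (hstep : ∀ r, 0 < r → r < R → Φ (ϑ * r) ≤ 2⁻¹ * Φ r + B)
    (htop : ∀ r, r₀ ≤ r → r < R → Φ r ≤ M) {r : ℝ} (hr : 0 < r) (hrR : r < R) :
    Φ r ≤ M + 2 * B := by
  have key : ∀ k : ℕ, ∀ r, ϑ ^ k * r₀ ≤ r → r < R → Φ r ≤ M + 2 * B := by
    intro k
    induction k with
    | zero =>
      intro r h1 h2
      rw [pow_zero, one_mul] at h1
      exact (htop r h1 h2).trans le_self_add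
    | succ k ih =>
      intro r h1 h2
      by_cases hk : ϑ ^ k * r₀ ≤ r
      · exact ih r hk h2
      have hk' : r < ϑ ^ k * r₀ := not_le.1 hk
      have hpk : 0 < ϑ ^ k := pow_pos hϑ k
      have hrpos : 0 < r := lt_of_lt_of_le (by positivity) h1
      have hkle : ϑ ^ k * r₀ ≤ r₀ := mul_le_of_le_one_left hr₀.le (pow_le_one₀ hϑ.le hϑ1.le)
      have hr' : r / ϑ < R := by
        rw [div_lt_iff₀ hϑ]
        nlinarith
      have h1' : ϑ ^ k * r₀ ≤ r / ϑ := by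
        rw [le_div_iff₀ hϑ]
        calc ϑ ^ k * r₀ * ϑ = ϑ ^ (k + 1) * r₀ := by ring
          _ ≤ r := h1
      have hstep' := hstep (r / ϑ) (div_pos hrpos hϑ) hr'
      have e : ϑ * (r / ϑ) = r := by field_simp
      rw [e] at hstep'
      calc Φ r ≤ 2⁻¹ * Φ (r / ϑ) + B := hstep'
        _ ≤ 2⁻¹ * (M + 2 * B) + B := by gcongr; exact ih _ h1' hr'
        _ = 2⁻¹ * M + (B + B) := by
          rw [mul_add, ← mul_assoc, ENNReal.inv_mul_cancel two_ne_zero ENNReal.ofNat_ne_top,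
            one_mul, add_assoc]
        _ ≤ M + 2 * B := by
          rw [two_mul]
          gcongr
          rw [← ENNReal.div_eq_inv_mul]
          exact ENNReal.half_le_self
  obtain ⟨n, hn⟩ := exists_pow_lt_of_lt_one (div_pos hr hr₀) hϑ1
  exact key n r ((lt_div_iff₀ hr₀).1 hn).le hrR

/-- **One step of the printed iteration**, abstractly (arXiv p. 10, the display after (as13)):
from (as12) with constant `K` at radius `2ϑr`, (as13) with constant `K` at `ϱ = ϑ r` and
`ϱ = 2ϑ r`, and the scaling `C(κ r) ≤ κ⁻² C(r)`, for `0 < ϑ ≤ 1/4`: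
`ℰ(ϑ r) ≤ (2K² + K) ϑ · D(r) + (6K + K²)(2ϑ)⁻² · C(r) + K (2ϑ)⁻²`, where `ℰ = E + A + D`
(the term `K (2ϑ)⁻²` comes from `C^{2/3} ≤ C + 1`).
[cite: SereginSverak2009, proof of Lemma 3.5 (arXiv p. 10)] -/
theorem decay_step {E A C D : ℝ → ℝ≥0∞} {K ϑ : ℝ≥0} (hϑ : 0 < ϑ) (hϑ4 : 4 * ϑ ≤ 1)
    (h12 : ∀ r ∈ Ioo (0 : ℝ) (1 / 4),
      E (r / 2) + A (r / 2) ≤ K * (C r ^ (2 / 3 : ℝ) + C r + D r))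
    (h13 : ∀ r ∈ Ioo (0 : ℝ) (1 / 4), ∀ κ : ℝ≥0, 0 < κ → κ ≤ 1 →
      D ((κ : ℝ) * r) ≤ K * (κ * D r + ((κ⁻¹ ^ 2 : ℝ≥0) : ℝ≥0∞) * C r))
    (hC : ∀ r ∈ Ioo (0 : ℝ) (1 / 4), ∀ κ : ℝ≥0, 0 < κ → κ ≤ 1 →
      C ((κ : ℝ) * r) ≤ ((κ⁻¹ ^ 2 : ℝ≥0) : ℝ≥0∞) * C r)
    {r : ℝ} (hr : r ∈ Ioo (0 : ℝ) (1 / 4)) :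
    E ((ϑ : ℝ) * r) + A ((ϑ : ℝ) * r) + D ((ϑ : ℝ) * r) ≤
      (((2 * K ^ 2 + K) * ϑ : ℝ≥0) : ℝ≥0∞) * D r +
        (((6 * K + K ^ 2) * (2 * ϑ)⁻¹ ^ 2 : ℝ≥0) : ℝ≥0∞) * C r +
        ((K * (2 * ϑ)⁻¹ ^ 2 : ℝ≥0) : ℝ≥0∞) := by
  have hϑR : (0 : ℝ) < ϑ := by exact_mod_cast hϑ
  have hϑR4 : 4 * (ϑ : ℝ) ≤ 1 := by exact_mod_cast hϑ4
  have hϑ1 : ϑ ≤ 1 := by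
    rw [← NNReal.coe_le_coe]; push_cast; linarith
  have h2ϑ : 0 < 2 * ϑ := by positivity
  have h2ϑ1 : 2 * ϑ ≤ 1 := by
    rw [← NNReal.coe_le_coe]; push_cast; linarith
  set q : ℝ≥0 := (2 * ϑ)⁻¹ ^ 2 with hq
  have hq1 : 1 ≤ q := one_le_pow₀ ((one_le_inv₀ h2ϑ).2 h2ϑ1)
  have hq1' : (1 : ℝ≥0∞) ≤ q := ENNReal.one_le_coe_iff.2 hq1
  have hq4 : ϑ⁻¹ ^ 2 = 4 * q := by
    rw [hq, mul_inv, mul_pow, ← mul_assoc]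
    norm_num
  -- the auxiliary radius `s = 2ϑr ≤ r/2`
  set s : ℝ := ((2 * ϑ : ℝ≥0) : ℝ) * r with hs
  have hs' : s = 2 * (ϑ : ℝ) * r := by rw [hs]; push_cast; ring
  have hs0 : 0 < s := by rw [hs']; exact mul_pos (mul_pos two_pos hϑR) hr.1
  have hsI : s ∈ Ioo (0 : ℝ) (1 / 4) := ⟨hs0, by rw [hs']; nlinarith [hr.1, hr.2]⟩
  have hs2 : s / 2 = (ϑ : ℝ) * r := by rw [hs']; ring
  have hEA := h12 s hsI
  rw [hs2] at hEA
  have hCs : C s ≤ (q : ℝ≥0∞) * C r := hC r hr (2 * ϑ) h2ϑ h2ϑ1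
  have hCs' : C s ^ (2 / 3 : ℝ) ≤ (q : ℝ≥0∞) * (C r + 1) := by
    calc C s ^ (2 / 3 : ℝ) ≤ ((q : ℝ≥0∞) * C r) ^ (2 / 3 : ℝ) := by gcongr
      _ = (q : ℝ≥0∞) ^ (2 / 3 : ℝ) * C r ^ (2 / 3 : ℝ) :=
          ENNReal.mul_rpow_of_nonneg _ _ (by norm_num)
      _ ≤ (q : ℝ≥0∞) ^ (1 : ℝ) * (C r + 1) :=
          mul_le_mul' (ENNReal.rpow_le_rpow_of_exponent_le hq1' (by norm_num))
            (rpow_two_thirds_le_add_one _)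
      _ = (q : ℝ≥0∞) * (C r + 1) := by rw [ENNReal.rpow_one]
  have hDs : D s ≤ K * ((2 * ϑ : ℝ≥0) * D r + (q : ℝ≥0∞) * C r) := h13 r hr (2 * ϑ) h2ϑ h2ϑ1
  have hDt : D ((ϑ : ℝ) * r) ≤ K * (ϑ * D r + ((4 * q : ℝ≥0) : ℝ≥0∞) * C r) := by
    have := h13 r hr ϑ hϑ hϑ1
    rwa [hq4] at this
  calc E ((ϑ : ℝ) * r) + A ((ϑ : ℝ) * r) + D ((ϑ : ℝ) * r)
      ≤ K * (C s ^ (2 / 3 : ℝ) + C s + D s) + K * (ϑ * D r + ((4 * q : ℝ≥0) : ℝ≥0∞) * C r) :=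
        add_le_add hEA hDt
    _ ≤ K * ((q : ℝ≥0∞) * (C r + 1) + (q : ℝ≥0∞) * C r +
          K * ((2 * ϑ : ℝ≥0) * D r + (q : ℝ≥0∞) * C r)) +
        K * (ϑ * D r + ((4 * q : ℝ≥0) : ℝ≥0∞) * C r) := by gcongr
    _ = (((2 * K ^ 2 + K) * ϑ : ℝ≥0) : ℝ≥0∞) * D r +
        (((6 * K + K ^ 2) * q : ℝ≥0) : ℝ≥0∞) * C r + ((K * q : ℝ≥0) : ℝ≥0∞) := by
        push_cast; ring

/-- **The contraction** `ℰ(ϑ r) ≤ ½ ℰ(r) + f₃` of the printed proof (arXiv p. 10: "We first chose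
`ϑ` so that `cϑ < 1/4`, pick up `ε` to provide the inequality `cε/ϑ² < 1/4`, and then we find
`ℰ(ϑr) ≤ ½ ℰ(r) + f₃`"), abstractly: `decay_step` combined with (as11) `C ≤ ε(E + A) + F` under
the smallness conditions `(2K² + K)ϑ ≤ ½`, `(6K + K²)(2ϑ)⁻² ε ≤ ½`; here
`f₃ = (6K + K²)(2ϑ)⁻² F + K(2ϑ)⁻²`. [cite: SereginSverak2009, proof of Lemma 3.5 (arXiv p. 10)] -/
theorem decay_step_half {E A C D : ℝ → ℝ≥0∞} {K F ε ϑ : ℝ≥0} (hϑ : 0 < ϑ) (hϑ4 : 4 * ϑ ≤ 1)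
    (hKϑ : (2 * K ^ 2 + K) * ϑ ≤ 2⁻¹) (hKε : (6 * K + K ^ 2) * (2 * ϑ)⁻¹ ^ 2 * ε ≤ 2⁻¹)
    (h11 : ∀ r ∈ Ioo (0 : ℝ) (1 / 4), C r ≤ ε * (E r + A r) + F)
    (h12 : ∀ r ∈ Ioo (0 : ℝ) (1 / 4),
      E (r / 2) + A (r / 2) ≤ K * (C r ^ (2 / 3 : ℝ) + C r + D r))
    (h13 : ∀ r ∈ Ioo (0 : ℝ) (1 / 4), ∀ κ : ℝ≥0, 0 < κ → κ ≤ 1 →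
      D ((κ : ℝ) * r) ≤ K * (κ * D r + ((κ⁻¹ ^ 2 : ℝ≥0) : ℝ≥0∞) * C r))
    (hC : ∀ r ∈ Ioo (0 : ℝ) (1 / 4), ∀ κ : ℝ≥0, 0 < κ → κ ≤ 1 →
      C ((κ : ℝ) * r) ≤ ((κ⁻¹ ^ 2 : ℝ≥0) : ℝ≥0∞) * C r)
    {r : ℝ} (hr : r ∈ Ioo (0 : ℝ) (1 / 4)) :
    E ((ϑ : ℝ) * r) + A ((ϑ : ℝ) * r) + D ((ϑ : ℝ) * r) ≤
      2⁻¹ * (E r + A r + D r) +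
        (((6 * K + K ^ 2) * (2 * ϑ)⁻¹ ^ 2 * F + K * (2 * ϑ)⁻¹ ^ 2 : ℝ≥0) : ℝ≥0∞) := by
  have h1 := decay_step (E := E) (A := A) hϑ hϑ4 h12 h13 hC hr
  have hKϑ' : (((2 * K ^ 2 + K) * ϑ : ℝ≥0) : ℝ≥0∞) ≤ 2⁻¹ := by
    have := ENNReal.coe_le_coe.2 hKϑ; simpa using this
  have hKε' : (((6 * K + K ^ 2) * (2 * ϑ)⁻¹ ^ 2 : ℝ≥0) : ℝ≥0∞) * ε ≤ 2⁻¹ := by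
    have := ENNReal.coe_le_coe.2 hKε; push_cast at this ⊢; simpa using this
  calc E ((ϑ : ℝ) * r) + A ((ϑ : ℝ) * r) + D ((ϑ : ℝ) * r)
      ≤ (((2 * K ^ 2 + K) * ϑ : ℝ≥0) : ℝ≥0∞) * D r +
        (((6 * K + K ^ 2) * (2 * ϑ)⁻¹ ^ 2 : ℝ≥0) : ℝ≥0∞) * C r +
        ((K * (2 * ϑ)⁻¹ ^ 2 : ℝ≥0) : ℝ≥0∞) := h1
    _ ≤ (((2 * K ^ 2 + K) * ϑ : ℝ≥0) : ℝ≥0∞) * D r +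
        (((6 * K + K ^ 2) * (2 * ϑ)⁻¹ ^ 2 : ℝ≥0) : ℝ≥0∞) * (ε * (E r + A r) + F) +
        ((K * (2 * ϑ)⁻¹ ^ 2 : ℝ≥0) : ℝ≥0∞) := by gcongr; exact h11 r hr
    _ = (((2 * K ^ 2 + K) * ϑ : ℝ≥0) : ℝ≥0∞) * D r +
        (((6 * K + K ^ 2) * (2 * ϑ)⁻¹ ^ 2 : ℝ≥0) : ℝ≥0∞) * ε * (E r + A r) +
        (((6 * K + K ^ 2) * (2 * ϑ)⁻¹ ^ 2 * F + K * (2 * ϑ)⁻¹ ^ 2 : ℝ≥0) : ℝ≥0∞) := by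
        push_cast; ring
    _ ≤ 2⁻¹ * D r + 2⁻¹ * (E r + A r) +
        (((6 * K + K ^ 2) * (2 * ϑ)⁻¹ ^ 2 * F + K * (2 * ϑ)⁻¹ ^ 2 : ℝ≥0) : ℝ≥0∞) := by
        gcongr
    _ = _ := by ring

/-- A ratio `0 < ϑ ≤ 1/4` with `L ϑ ≤ ½` ("We first chose `ϑ` so that `cϑ < 1/4`").
[folklore] -/
theorem exists_ratio (L : ℝ≥0) : ∃ ϑ : ℝ≥0, 0 < ϑ ∧ 4 * ϑ ≤ 1 ∧ L * ϑ ≤ 2⁻¹ := by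
  refine ⟨(4 + 2 * L)⁻¹, by positivity, ?_, ?_⟩
  · rw [← NNReal.coe_le_coe]; push_cast
    rw [mul_inv_le_iff₀ (by positivity)]
    linarith [L.coe_nonneg]
  · rw [← NNReal.coe_le_coe]; push_cast
    rw [mul_inv_le_iff₀ (by positivity)]
    linarith [L.coe_nonneg]

/-- A parameter `ε > 0` with `L ε ≤ ½` ("pick up `ε` to provide the inequality
`cε/ϑ² < 1/4`"). [folklore] -/
theorem exists_parameter (L : ℝ≥0) : ∃ ε : ℝ≥0, 0 < ε ∧ L * ε ≤ 2⁻¹ := by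
  refine ⟨(2 + 2 * L)⁻¹, by positivity, ?_⟩
  rw [← NNReal.coe_le_coe]; push_cast
  rw [mul_inv_le_iff₀ (by positivity)]
  linarith [L.coe_nonneg]

end SereginSverak2009

end Literature.Analysis.FluidPDE
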